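import Summits.QuantumFields.BalabanUV.Beta.D1BFx.TorusCoframeJets
import Summits.QuantumFields.BalabanUV.Beta.D1BFx.GhostStencil
import Literature.MathematicalPhysics.QuantumFieldTheory.Balaban1983to89.Beta.VolumeConvolution

/-!
# `BalabanUV.Beta.D1BFx.TorusJetArrays` — road «BF-x» for binder row D1, slot (K), X₃(ii) ROUTE T, owner row **«TB4-W»** (K-ASSEMBLY-SPEC v2.5 §3 (T3);
# ruling ρ-g6-13 (1): «periodise the jets … as periodised ARRAYS indexed by the background bond `(κ,u)` (TA2 `PeriodicArrays.arr` currency, so that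
# `SortedTraces` applies)»), PART 3b-β FILE 1 — **THE ARRAY DICTIONARY FOR THE LOCAL TORUS JETS**: PART 2's explicit torus jets of the covariant
# Laplacian at the torus bond `(siteOf u, κ)` ARE the fibrewise periodisations of TA2's ARRAYS of the `ℤ⁴` stencils at the fine bond `(κ, u)`:
# **`Ljet s (σu, κ) = (arr s (GhostStencil.ghCur κ u))^`** (the first jet = the array of the typer's ghost current = PART 1's `lap₁`),
# **`Ljet₂ s (σu, κ) = −((arr s (ptPair u (u+e)))^ + (arr s (ptPair (u+e) u))^)`** (the pure second jet = minus the arrayed hop = PART 1's `lap₂`),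
# via the general point-pair rule `(arr s (ptPair p q))^ x̄ z̄ = [x̄ = σp][z̄ = σq]` (every finite stencil is a `ℤ`-combination of point pairs)

HONEST DEPENDENCY (cell records, verbatim): «continuum YM on T⁴ ⇐ BetaPertH ∧ nine spine estimates (0/9 proved); BetaPertH ⇐ (D1) ∧ (D4) ∧
CAP+tail; G-an2-4 gates asym, D1 and NE2/3/4.»  HONEST FRAMING (cell contract, verbatim): «discharging `BetaPertH` makes Bałaban's UV stability
UNCONDITIONAL — a real constructive-QFT result; it is NOT the continuum limit and NOT the Clay problem.»  THIS MODULE DISCHARGES NOTHING of (K),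
of D1 or of the wall: one [our object] data definition (`ptPair`, a point-pair indicator kernel) and [folklore] image-sum bookkeeping over
gan24-leaf-06-g29's TA2 `PeriodicArrays` (`arr`, `toF`, `periodise₂_arr`), an4's `periodise₂`∕`siteOf`∕`imageShift` dictionary
(`exists_eq_imageShift_of_siteOf_eq`, `siteOf_imageShift`, `imageShift_injective`), the typer's `GhostStencil.ghCur`∕`biLoc_ghCur` (T6) and PART 2
`TorusCoframeJets` (`Ljet_apply`, `Ljet₂_apply`, `tip`), BY NAME.  No `def … : Prop`, nothing cited, no wall binder instantiated, 0 sorry.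
0∕4 binders of row D1; (K) NOT closed; NOT D1, NOT BetaPertH, NOT continuum, NOT Clay.

ABSOLUTE RULE (cell charter, verbatim): «No internally-minted statement may enter as a cited fact. Every hypothesis is either kernel-proved in this
package or a verbatim quotation of a PUBLISHED theorem with page reference. The manuscript(s) under audit are NOT citable for their own disputed
steps — they are the thing under adjudication; programme-internal (2001/route/tribunal) claims are never citable.»

CONTENT (`σ := siteOf 4 s`, `x̂ := windowMap 4 s x̄`, `e := unitVec κ`):
* §1 [folklore] image-sum indicators: `tsum_ind` (`Σ'_t [x̂ + s·t = p]·c = [x̄ = σp]·c`), `summable_ind`, `tsum_tsum_ind_and`.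
* §2 [our object] `ptPair p q : MKer 4 Unit` (`[x = p][z = q]`); [folklore] `biLoc_ptPair`, **`periodise_arr_ptPair`** (`= [x̄ = σp ∧ z̄ = σq]`),
  `ghCur_eq_ptPair_sub` (`ghCur κ u = ptPair (u+e) u − ptPair u (u+e)`).
* §3 [folklore] **`Ljet_apply_eq_arr : Ljet s (σu, κ) x̄ z̄ = periodiseF s (toF (arr s (ghCur κ u))) (x̄,⋆) (z̄,⋆)`** and the matrix form `Ljet_eq_arr`;
  **`Ljet₂_apply_eq_arr`** ∕ `Ljet₂_eq_arr`; `Ljet₁₁_eq_arr` (`[b̄ = b̄′]•` the arrayed hop — on the torus the mixed jet tests equality of TORUS bonds).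
NOT HERE (FILE 2 `TorusJetSandwichArrays`): the sandwich words `D̂ŶD̂ᵀ = (dSw Y)^`, `Ê_{(σu,κ)}ŶD̂ᵀ = (arr (Ḋ∘Y∘dᵀ))^`, `D̂ŶÊᵀ = (arr (d∘Y∘Ḋᵀ))^` for jointly
periodic decaying `Y` (the formal anchors of `Mjet₁`'s product rule and of the J5 junction `twgt₁ = (dSw Ṙ − dJetSw R)^`); TB4-tables (T1), (T2-kin), TB5.
Provenance: D1 formalisation swarm, unit `b2b-balaban-beta-d1-formalise-leaf-03` (gen 9), claim «TB4-W» journal l.23490 ∕ plan l.24110, 2026-08-21.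
-/

noncomputable section

namespace Summit.QuantumFields.BalabanUV.Beta.D1BFx.TorusJetArrays

open Matrix
open scoped BigOperators
open Literature.MathematicalPhysics.QuantumFieldTheory.Balaban1983to89
open Literature.MathematicalPhysics.QuantumFieldTheory.Balaban1983to89.Beta
open B12Sec2to5 (l1 l1_nonneg)
open ExpKernelCalculus (MKer BiLoc)
open AffineAveraging (unitVec)
open Summit.QuantumFields.BalabanUV.Beta.D1BFx.PeriodicArrays (arr toF toF_apply Kfib_toF periodise₂_arr)
open Summit.QuantumFields.BalabanUV.Beta.D1BFx.FibredPeriodisation (Kfib Kfib_apply periodiseF periodiseF_apply)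
open Summit.QuantumFields.BalabanUV.Beta.D1BFx.GhostStencil (ghCur ghCur_apply biLoc_ghCur l1_zero)
open Summit.QuantumFields.BalabanUV.Beta.D1BFx.TorusCoframeJets (tip Djet Ljet Ljet₂ Ljet₁₁ Ljet_apply Ljet₂_apply Ljet₁₁_self Ljet₁₁_of_ne)

variable {d : ℕ} (s : ℕ) [NeZero s]

/-! ## §1 Image sums of indicators -/

/-- [folklore] **ONE IMAGE AT MOST**: `Σ'_t [x̂ + s·t = p]·c = [x̄ = σ p]·c` (`x̂` the window representative of the torus point `x̄`). -/
theorem tsum_ind (x : Site d s) (p : Fin d → ℤ) (c : ℝ) :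
    ∑' t : Fin d → ℤ, (if imageShift s (windowMap d s x) t = p then c else 0) = if x = siteOf d s p then c else 0 := by
  by_cases hx : x = siteOf d s p
  · obtain ⟨m, hm⟩ := exists_eq_imageShift_of_siteOf_eq hx.symm
    rw [if_pos hx, tsum_eq_single m (fun t ht => if_neg (fun h => ht (imageShift_injective s _ (h.trans hm))))]
    rw [if_pos hm.symm]
  · rw [if_neg hx]
    refine (tsum_congr fun t => ?_).trans tsum_zero
    rw [if_neg]
    intro h
    exact hx (by rw [← h, siteOf_imageShift, siteOf_windowMap])

/-- [folklore] The indicator family of §1 is summable (at most one non-zero term). -/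
theorem summable_ind (x : Site d s) (p : Fin d → ℤ) (c : ℝ) :
    Summable fun t : Fin d → ℤ => (if imageShift s (windowMap d s x) t = p then c else 0) := by
  by_cases hx : x = siteOf d s p
  · obtain ⟨m, hm⟩ := exists_eq_imageShift_of_siteOf_eq hx.symm
    exact summable_of_ne_finset_zero (s := {m}) fun t ht => by
      rw [Finset.mem_singleton] at ht
      exact if_neg (fun h => ht (imageShift_injective s _ (h.trans hm)))
  · refine (summable_zero).congr fun t => ?_
    rw [if_neg]
    intro h
    exact hx (by rw [← h, siteOf_imageShift, siteOf_windowMap])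

/-- [folklore] **DOUBLE IMAGE SUM OF A POINT-PAIR INDICATOR**: `Σ'_t Σ'_n [x̂ + s·t = p ∧ ẑ + s·n = q]·c = [x̄ = σp ∧ z̄ = σq]·c`. -/
theorem tsum_tsum_ind_and (x z : Site d s) (p q : Fin d → ℤ) (c : ℝ) :
    ∑' t : Fin d → ℤ, ∑' n : Fin d → ℤ,
        (if imageShift s (windowMap d s x) t = p ∧ imageShift s (windowMap d s z) n = q then c else 0)
      = if x = siteOf d s p ∧ z = siteOf d s q then c else 0 := by
  have inner : ∀ t : Fin d → ℤ, ∑' n : Fin d → ℤ,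
      (if imageShift s (windowMap d s x) t = p ∧ imageShift s (windowMap d s z) n = q then c else 0)
        = if imageShift s (windowMap d s x) t = p then (if z = siteOf d s q then c else 0) else 0 := by
    intro t
    by_cases ht : imageShift s (windowMap d s x) t = p
    · simp only [ht, true_and, if_true, tsum_ind]
    · simp only [ht, false_and, if_false, tsum_zero]
  rw [tsum_congr inner, tsum_ind]
  by_cases hx : x = siteOf d s p <;> by_cases hz : z = siteOf d s q <;> simp [hx, hz]

/-! ## §2 Point pairs on `ℤ⁴` and their arrayed periodisation -/

/-- [our object] **THE POINT-PAIR INDICATOR KERNEL** `ptPair p q x z = [x = p][z = q]` (fibre `Unit`) — every finite stencil of the road is a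
`ℤ`-combination of these.  A definition; asserts nothing. -/
def ptPair (p q : Fin 4 → ℤ) : MKer 4 Unit := fun x z _ _ => if x = p ∧ z = q then 1 else 0

/-- [our object] Unfolding `ptPair`. -/
@[simp] theorem ptPair_apply (p q x z : Fin 4 → ℤ) (a b : Unit) : ptPair p q x z a b = if x = p ∧ z = q then (1 : ℝ) else 0 := rfl

/-- [folklore] LOCALISATION SOCKET: `BiLoc (ptPair p q) p q 1 δ` (every real `δ`). -/
theorem biLoc_ptPair (p q : Fin 4 → ℤ) (δ : ℝ) : BiLoc (ptPair p q) p q 1 δ := by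
  intro x z a b
  rw [ptPair_apply]
  by_cases h : x = p ∧ z = q
  · rw [if_pos h, h.1, h.2, sub_self, sub_self, abs_one, l1_zero, add_zero, mul_zero, Real.exp_zero, mul_one]
  · rw [if_neg h, abs_zero]; positivity

/-- [folklore] **THE POINT-PAIR RULE**: the periodised array of `ptPair p q` is the single-entry torus matrix at `(σp, σq)`:
`periodiseF s (toF (arr s (ptPair p q))) (x̄,⋆) (z̄,⋆) = [x̄ = σp ∧ z̄ = σq]` (TA2 `periodise₂_arr` + §1). -/
theorem periodise_arr_ptPair (p q : Fin 4 → ℤ) (x z : Site 4 s) (a b : Unit) :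
    periodiseF s (toF (arr s (ptPair p q))) (x, a) (z, b) = if x = siteOf 4 s p ∧ z = siteOf 4 s q then (1 : ℝ) else 0 := by
  rw [periodiseF_apply, periodise₂_arr (biLoc_ptPair p q 1) one_pos]
  simp only [ptPair_apply]
  exact tsum_tsum_ind_and s x z p q 1

/-- [folklore] **THE GHOST CURRENT IS A DIFFERENCE OF TWO POINT PAIRS**: `ghCur κ u = ptPair (u+e) u − ptPair u (u+e)`. -/
theorem ghCur_eq_ptPair_sub (κ : Fin 4) (u : Fin 4 → ℤ) : ghCur κ u = ptPair (u + unitVec κ) u - ptPair u (u + unitVec κ) := by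
  funext x z a b
  rfl

/-! ## §3 The torus jets of the covariant Laplacian are the periodised arrays of the `ℤ⁴` stencils -/

section Jets

variable (κ : Fin 4) (u : Fin 4 → ℤ)

omit [NeZero s] in
/-- [folklore] `tip (σu, κ) = σ(u + e_κ)`. -/
theorem tip_siteOf : tip s (siteOf 4 s u, κ) = siteOf 4 s (u + unitVec κ) := by
  rw [tip, siteOf_add]

/-- [folklore] **`Ljet = (arr ghCur)^` ENTRYWISE**: the torus first jet of `L̂_U` at the torus bond `(σu, κ)` is the fibrewise periodisation of the ARRAY of
the typer's ghost current at the fine bond `(κ, u)` (= PART 1's `lap₁ κ u` read as an `MKer`). -/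
theorem Ljet_apply_eq_arr (x z : Site 4 s) (a b : Unit) :
    Ljet s (siteOf 4 s u, κ) x z = periodiseF s (toF (arr s (ghCur κ u))) (x, a) (z, b) := by
  rw [Ljet_apply, tip_siteOf, periodiseF_apply, periodise₂_arr (biLoc_ghCur κ u 1) one_pos]
  simp only [ghCur_apply]
  have hsub : ∀ t : Fin 4 → ℤ, ∑' n : Fin 4 → ℤ,
      ((if imageShift s (windowMap 4 s x) t = u + unitVec κ ∧ imageShift s (windowMap 4 s z) n = u then (1 : ℝ) else 0)
        - (if imageShift s (windowMap 4 s x) t = u ∧ imageShift s (windowMap 4 s z) n = u + unitVec κ then (1 : ℝ) else 0))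
      = (if imageShift s (windowMap 4 s x) t = u + unitVec κ then (if z = siteOf 4 s u then (1 : ℝ) else 0) else 0)
        - (if imageShift s (windowMap 4 s x) t = u then (if z = siteOf 4 s (u + unitVec κ) then (1 : ℝ) else 0) else 0) := by
    intro t
    rw [Summable.tsum_sub]
    · congr 1
      · by_cases ht : imageShift s (windowMap 4 s x) t = u + unitVec κ
        · simp only [ht, true_and, if_true, tsum_ind]
        · simp only [ht, false_and, if_false, tsum_zero]
      · by_cases ht : imageShift s (windowMap 4 s x) t = u
        · simp only [ht, true_and, if_true, tsum_ind]
        · simp only [ht, false_and, if_false, tsum_zero]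
    · by_cases ht : imageShift s (windowMap 4 s x) t = u + unitVec κ
      · simp only [ht, true_and]; exact summable_ind s z u 1
      · simp only [ht, false_and, if_false]; exact summable_zero
    · by_cases ht : imageShift s (windowMap 4 s x) t = u
      · simp only [ht, true_and]; exact summable_ind s z (u + unitVec κ) 1
      · simp only [ht, false_and, if_false]; exact summable_zero
  rw [tsum_congr hsub, Summable.tsum_sub (summable_ind s x _ _) (summable_ind s x _ _), tsum_ind, tsum_ind]
  simp only [ite_zero_mul_ite_zero, mul_one, ite_and]

/-- [folklore] **`Ljet = (arr ghCur)^`** as torus matrices (the `Unit` fibre re-indexed away). -/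
theorem Ljet_eq_arr : Ljet s (siteOf 4 s u, κ)
    = (Matrix.of (periodiseF s (toF (arr s (ghCur κ u))))).submatrix (fun x => (x, ())) (fun z => (z, ())) := by
  ext x z
  rw [Matrix.submatrix_apply, Matrix.of_apply]
  exact Ljet_apply_eq_arr s κ u x z () ()

/-- [folklore] **`Ljet₂ = −((arr (ptPair u (u+e)))^ + (arr (ptPair (u+e) u))^)` ENTRYWISE**: the torus pure second jet of `L̂_U` at `(σu, κ)` is minus the
periodised array of the symmetric hop across the fine bond (= PART 1's `lap₂ κ u`, which is `−(ptPair u (u+e) + ptPair (u+e) u)` read as an `MKer`). -/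
theorem Ljet₂_apply_eq_arr (x z : Site 4 s) (a b : Unit) :
    Ljet₂ s (siteOf 4 s u, κ) x z
      = -(periodiseF s (toF (arr s (ptPair u (u + unitVec κ)))) (x, a) (z, b)
          + periodiseF s (toF (arr s (ptPair (u + unitVec κ) u))) (x, a) (z, b)) := by
  rw [Ljet₂_apply, tip_siteOf, periodise_arr_ptPair, periodise_arr_ptPair]
  simp only [ite_zero_mul_ite_zero, mul_one]

/-- [folklore] **`Ljet₂ = −((arr (ptPair u (u+e)))^ + (arr (ptPair (u+e) u))^)`** as torus matrices. -/
theorem Ljet₂_eq_arr : Ljet₂ s (siteOf 4 s u, κ)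
    = (-(Matrix.of (periodiseF s (toF (arr s (ptPair u (u + unitVec κ)))))
        + Matrix.of (periodiseF s (toF (arr s (ptPair (u + unitVec κ) u)))))).submatrix (fun x => (x, ())) (fun z => (z, ())) := by
  ext x z
  rw [Matrix.submatrix_apply, Matrix.neg_apply, Matrix.add_apply, Matrix.of_apply, Matrix.of_apply]
  exact Ljet₂_apply_eq_arr s κ u x z () ()

/-- [folklore] **THE MIXED JET**: for two background fine bonds `(κ,u)`, `(l,u′)` the torus mixed jet is `[(σu,κ) = (σu′,l)]•` (minus the arrayed hop)
— on the torus the test is equality of the IMAGE bonds (for `u − u′ ∉ s·ℤ⁴ ∖ {0}` it is the `ℤ⁴` test of PART 1's `lap₁₁`). -/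
theorem Ljet₁₁_eq_arr (l : Fin 4) (u' : Fin 4 → ℤ) : Ljet₁₁ s (siteOf 4 s u, κ) (siteOf 4 s u', l)
    = if (siteOf 4 s u, κ) = (siteOf 4 s u', l) then
        (-(Matrix.of (periodiseF s (toF (arr s (ptPair u (u + unitVec κ)))))
          + Matrix.of (periodiseF s (toF (arr s (ptPair (u + unitVec κ) u)))))).submatrix (fun x => (x, ())) (fun z => (z, ()))
      else 0 := by
  by_cases h : (siteOf 4 s u, κ) = (siteOf 4 s u', l)
  · rw [if_pos h, ← h, Ljet₁₁_self, Ljet₂_eq_arr]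
  · rw [if_neg h, Ljet₁₁_of_ne s _ _ h]

end Jets

end Summit.QuantumFields.BalabanUV.Beta.D1BFx.TorusJetArrays

end
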